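import Summits.QuantumFields.YangMills.Theorems.BalabanUVNodesN21ShellSplitOfRecord13CoPHFibre
import Summits.QuantumFields.YangMills.Theorems.BalabanUVNodesN21ShellSplitOfRecord13CoPHKeyed
import Literature.MathematicalPhysics.QuantumFieldTheory.Balaban1983to89.Node00.CubeRoughSection

/-!
# N21 (NE7c) · THE SHELL SPLIT OF RECORD, THE STATISTIC AND THE END: the cube statistic of record `sup_{p⊂a^∼}|U_{k,a}(V)(∂p) − 1|∕η_k²` reads the cube's two
# (2.17) tests and only the input block of record; hence N21's face AT `crOfRecord₁₃At K₀ jcut (shellSplitOfRecord₁₃At …)` from ONE displayed estimate per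
# (run, K, t, top cube a, exterior field x): `T4ShellMeasure.SlotAntiConcentration` of the BLOCK FIBRE LAW of record on `(SU N)^{inputBlock a}` for ONE function of the
# block variables — with `Σ_K D_K ρ_K < ∞`

R134 seat `pub-ymgap-dag-n21-d` (g9), node N21 = NE7c (NOT PRINTED, NOT proved), strategy s2; lane K3⁷ `SpineGivenEndpointR13SepCoPH` (stmt-QuantumFields-20544,
`--supports … --as helper`; COUNT-NEUTRAL).  Imports `…Fibre` (disintegration + locality) and `…Keyed` (the face at the record).  [III] = [Balaban1988Convergent].

WHAT THIS FILE PROVES (theorems only; 0 `def`, 0 `sorry`).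
* §1 THE STATISTIC READS THE TESTS: `eta_pos_record` · `plaqInside_cubeEnl_nonempty` (every top cube has a plaquette in `a^∼` — n11-a's `cornerPlaq_mem_plaqInside`
  BY NAME, torus geometry) · ★ `cubeStat_lt_iff` — for a cube with a nonempty plaquette family, `cubeStat a V < δ ↔ χ_a^{δ}(V) = 1` (the (2.17)
  test at the letter `δ` PASSES iff the statistic is below `δ`; `Finset.sup'_lt_iff`) · `measurable_cubeStat` ((H-U)).
* §2 LOCALITY: ★ `cubeStat_congr_of_agree_inputs` (the statistic reads `V` only on `liftIter k (inputs 𝐁_k(a^{∼4}))`, r11's `ukBox_congr` + [III] (2.12)'s locality BY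
  NAME) · ★ `blockReading_cubeStat_inputBlock` (on the input block of record the fibre reading of the statistic does not see the exterior: `= blockReading … 1`).
* §3 ★★★★ `shellWeightBound_crOfRecord₁₃At_shellSplit_of_blockFibreAC` — N21's face AT THE SPINE READING OF RECORD WITH ITS SHELL SPLIT, on the live-selector line,
  from: n20-d's extraction rows (`hsel`, (H-U), (H-ζ), `0 ≤ ζ`), width letters `0 ≤ ρ`,
  constants `0 ≤ D`, `Summable (D_K ρ_K)` per run, and THE ONE ESTIMATE per (run, K, t, top cube a, exterior field x):
  `SlotAntiConcentration (blockFibreLawOfDatum₉ … t a (inputBlock a) x) (blockReading (cubeStat a) (inputBlock a) 1) ε_k ρ_K D_K`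
  — anti-concentration, at relative scale `ρ_K` below the threshold `ε_k` of record, of ONE explicit function of the block variables `y ∈ (SU N)^{inputBlock a}` under
  the product-Haar law with the explicit density «the dressed (2.18) integrand of record with the exterior `x` frozen».  Everything else — (R), cover, count, keying,
  canonical `Wsh`, F3's integrability, the law ↔ integral bridge, the disintegration, the locality — is PROVED in FILES 1–5 and here.

HONEST FRAMING.  By-name composition of FILES 2–5 + [folklore] (`Finset.sup'`); NO estimate; nothing of Bałaban's asserted; the displayed (M1) is NOT PRINTED and NOT
proved (the dilation ∕ hazard roads, parts 7–39, and n21-e ∕ n21-w1's chart transports are its reductions); A6: the zero width is the junk instance; K0⁷ open; NE7c NOT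
proved; N21 NOT discharged; K3⁷ NOT claimed; counts UNMOVED (typed 28∕28 · discharged 5∕27); never a count claim.  No `instance`, no `notation`, no `def`.  One finite
four-torus programme at fixed `ε` — NOT ℝ⁴, NOT OS, NOT a mass gap, NOT the Clay problem.
-/

noncomputable section

open scoped BigOperators ENNReal
open Finset MeasureTheory

namespace Summit.QuantumFields.YangMills.Theorems.N21ShellSplitOfRecord13CoPH

open Literature.MathematicalPhysics.QuantumFieldTheory.Balaban1983to89
open Literature.MathematicalPhysics.QuantumFieldTheory.Balaban1983to89.T4Continuum
open Literature.MathematicalPhysics.QuantumFieldTheory.Balaban1983to89.Node00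
open T4ShellMeasure (SlotAntiConcentration)
open T4IndicatorShell (ShellWeightBound)
open YMDAG.UVSplit (crOfRecord₁₃At ShellSplit₁₃CoPH runA₁₃ runB₁₃ histA₁₃ histB₁₃)
open B14.Eq216Concrete (ukBox_congr inputs liftIter)
open B14.Eq213DetSet (Bj)
open B16Eq150VariableFields (isMinimizer_of_agreeOn agreeOn_symm)
open Summit.QuantumFields.YangMills.BalabanUVNodes.N19MGFFormAtRecord (wOfRecord₉_nonneg)

/-! ## §1 The cube statistic of record reads the cube's (2.17) tests -/

section Stat

variable (F : T4Family) (N : ℕ) [NeZero N] (ν : Stage7Numerics) (g : ℕ → ℝ) (Kc k : ℕ)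

/-- `η_k = L^{−k} > 0`. [bookkeeping] -/
theorem eta_pos_record : 0 < (F.P Kc).eta k :=
  pow_pos (inv_pos.2 (Nat.cast_pos.2 (F.P Kc).L_pos)) k

/-- ★ **THE STATISTIC READS THE TEST**: for a top cube `a` whose plaquette family `{p ⊂ a^∼}` is nonempty, `cubeStat a V < δ ↔ χ_a^{δ}(V) = 1` — the (2.17) test of record
at the letter `δ` passes iff the sup of the (2.16) plaquette variables over `η_k²` is below `δ`. [bookkeeping] -/
theorem cubeStat_lt_iff (a : ↥(cubeIndices (F.P Kc) (cubeSide (F.P Kc).L ν.M₂ (RkOfRecord (F.P Kc).L ν.r (g k)) k)))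
    (hne : (plaqInside (cubeEnl (F.P Kc) (cubeSide (F.P Kc).L ν.M₂ (RkOfRecord (F.P Kc).L ν.r (g k)) k) a 1)).Nonempty)
    (δ : ℝ) (V : GaugeField (F.P Kc) k (SU N)) :
    cubeStat F N ν g a V < δ ↔ cubeChiAt F N ν g Kc k δ a V = 1 := by
  have hη : 0 < (F.P Kc).eta k ^ 2 := pow_pos (eta_pos_record F Kc k) 2
  have hS : (Set.toFinite (plaqInside (cubeEnl (F.P Kc) (cubeSide (F.P Kc).L ν.M₂ (RkOfRecord (F.P Kc).L ν.r (g k)) k) a 1))).toFinset.Nonempty :=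
    (Set.Finite.toFinset_nonempty _).2 hne
  unfold cubeStat
  simp only
  rw [dif_pos hS, div_lt_iff₀ hη, Finset.sup'_lt_iff]
  unfold cubeChiAt chiSmall
  constructor
  · intro h
    rw [if_pos]
    exact fun p hp => h p ((Set.Finite.mem_toFinset _).2 hp)
  · intro h p hp
    by_cases hsm : PlaqSmallOn (plaqInside (cubeEnl (F.P Kc) (cubeSide (F.P Kc).L ν.M₂ (RkOfRecord (F.P Kc).L ν.r (g k)) k) a 1))
        (δ * (F.P Kc).eta k ^ 2)
        (B14.Eq216Concrete.ukBox (bgOfRecord (avOfRecord F N Kc) {U | PlaqSmall (ν.εreg * (F.P Kc).eta k ^ 2) U}) ν.M₁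
          (cubeEnl (F.P Kc) (cubeSide (F.P Kc).L ν.M₂ (RkOfRecord (F.P Kc).L ν.r (g k)) k) a 4) k V)
    · exact hsm p ((Set.Finite.mem_toFinset _).1 hp)
    · rw [if_neg hsm] at h; exact absurd h zero_ne_one

/-- **EVERY TOP CUBE HAS A PLAQUETTE IN `a^∼`** (torus geometry, COUNTED not assumed): a cube index exists only for a positive side `L^{k+1}M₂R_k ≥ L`, and then n11-a's
`cornerPlaq_mem_plaqInside` places the block-corner `(0,1)`-plaquette inside `a^∼` (`d = 4`). [bookkeeping] -/
theorem plaqInside_cubeEnl_nonempty (a : ↥(cubeIndices (F.P Kc) (cubeSide (F.P Kc).L ν.M₂ (RkOfRecord (F.P Kc).L ν.r (g k)) k))) :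
    (plaqInside (cubeEnl (F.P Kc) (cubeSide (F.P Kc).L ν.M₂ (RkOfRecord (F.P Kc).L ν.r (g k)) k) a 1)).Nonempty := by
  obtain ⟨x, hx⟩ := a
  rcases Nat.eq_zero_or_pos (cubeSide (F.P Kc).L ν.M₂ (RkOfRecord (F.P Kc).L ν.r (g k)) k) with h0 | hpos
  · exfalso
    rw [h0] at hx
    haveI : Nonempty (Fin (F.P Kc).d) := ⟨⟨0, (F.P Kc).hd⟩⟩
    simp [cubeIndices] at hx
    exact Finset.notMem_empty x hx
  · have hL : (F.P Kc).L ≤ cubeSide (F.P Kc).L ν.M₂ (RkOfRecord (F.P Kc).L ν.r (g k)) k := by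
      unfold cubeSide at hpos ⊢
      have hMR : 1 ≤ ν.M₂ * RkOfRecord (F.P Kc).L ν.r (g k) := by
        rcases Nat.eq_zero_or_pos (ν.M₂ * RkOfRecord (F.P Kc).L ν.r (g k)) with h | h
        · rw [mul_assoc, h, mul_zero] at hpos; exact absurd hpos (lt_irrefl 0)
        · exact h
      have hLpos : 0 < (F.P Kc).L := (F.P Kc).L_pos
      calc (F.P Kc).L = (F.P Kc).L ^ 1 * 1 := by ring
        _ ≤ (F.P Kc).L ^ (k + 1) * (ν.M₂ * RkOfRecord (F.P Kc).L ν.r (g k)) :=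
            Nat.mul_le_mul (Nat.pow_le_pow_right hLpos (by omega)) hMR
        _ = (F.P Kc).L ^ (k + 1) * ν.M₂ * RkOfRecord (F.P Kc).L ν.r (g k) := by ring
    have hd : (F.P Kc).d = 4 := rfl
    exact ⟨_, cornerPlaq_mem_plaqInside (P := F.P Kc) hL x (μ := ⟨0, by omega⟩) (ν := ⟨1, by omega⟩) (by simp)⟩

/-- pointwise form of Mathlib's `Finset.measurable_sup'` (real-valued). [folklore] -/
private theorem measurable_finsetSup'_pointwise {ι X : Type*} [MeasurableSpace X] (S : Finset ι) (h : S.Nonempty) {f : ι → X → ℝ}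
    (hm : ∀ q ∈ S, Measurable (f q)) : Measurable (fun V => S.sup' h (fun q => f q V)) := by
  have hfun : (fun V => S.sup' h (fun q => f q V)) = S.sup' h f := by
    funext V; exact (Finset.sup'_apply h f V).symm
  rw [hfun]
  exact Finset.measurable_sup' h hm

/-- **THE STATISTIC IS MEASURABLE UNDER (H-U)** (a finite sup of `dist1 ∘ plaqHol ∘` the measurable (2.16) solution map, over `η_k²`). [bookkeeping] -/
theorem measurable_cubeStat (hU : LocalBgMeasurable F N ν)
    (a : ↥(cubeIndices (F.P Kc) (cubeSide (F.P Kc).L ν.M₂ (RkOfRecord (F.P Kc).L ν.r (g k)) k))) :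
    Measurable (cubeStat F N ν g (Kc := Kc) (k := k) a) := by
  unfold cubeStat
  simp only
  split_ifs with h
  · refine Measurable.div_const (measurable_finsetSup'_pointwise _ h fun q _ => ?_) _
    exact RegularGaugeGroup.measurable_dist1.comp ((Missing.measurable_plaqHol q).comp (hU Kc k _))
  · exact measurable_const

end Stat

/-! ## §2 Locality: the statistic reads only the input block of record -/

section Locality

variable (F : T4Family) (N : ℕ) [NeZero N] (ν : Stage7Numerics) (g : ℕ → ℝ) (Kc k : ℕ)

/-- ★ **LOCALITY OF THE CUBE STATISTIC OF RECORD**: it depends on `V` only on `liftIter k (inputs 𝐁_k(a^{∼4}))` (r11's `ukBox_congr`, the (2.12) solution map of record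
being a function of the (2.12) predicate, which reads its datum on the determining set only — [III] (2.12) p. 256). [bookkeeping] -/
theorem cubeStat_congr_of_agree_inputs (hk : k ≤ F.m + Kc)
    (a : ↥(cubeIndices (F.P Kc) (cubeSide (F.P Kc).L ν.M₂ (RkOfRecord (F.P Kc).L ν.r (g k)) k))) {V W : GaugeField (F.P Kc) k (SU N)}
    (h : ∀ c ∈ liftIter k (inputs (Bj ν.M₁ (cubeEnl (F.P Kc) (cubeSide (F.P Kc).L ν.M₂ (RkOfRecord (F.P Kc).L ν.r (g k)) k) a 4) k)), V c = W c) :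
    cubeStat F N ν g a V = cubeStat F N ν g a W := by
  unfold cubeStat
  simp only
  rw [ukBox_congr (bgOfRecord (avOfRecord F N Kc) {U | PlaqSmall (ν.εreg * (F.P Kc).eta k ^ 2) U}) ν.M₁ hk (fun X X' hXX' => ?_) h]
  exact UminOfRecord_congr_of_isMinimizer_iff₀ _ _ fun U₀ => ⟨isMinimizer_of_agreeOn hXX', isMinimizer_of_agreeOn (agreeOn_symm hXX')⟩

/-- ★ **ON THE INPUT BLOCK OF RECORD THE FIBRE READING OF THE STATISTIC DOES NOT SEE THE EXTERIOR**: `blockReading (cubeStat a) (inputBlock a) x = blockReading … 1` for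
every exterior field `x` — so the fibre (M1) is about ONE function of the block variables. [bookkeeping] -/
theorem blockReading_cubeStat_inputBlock (hk : k ≤ F.m + Kc)
    (a : ↥(cubeIndices (F.P Kc) (cubeSide (F.P Kc).L ν.M₂ (RkOfRecord (F.P Kc).L ν.r (g k)) k))) (x : GaugeField (F.P Kc) k (SU N)) :
    blockReading N (cubeStat F N ν g (Kc := Kc) (k := k) a) (inputBlock F ν g a) x =
      blockReading N (cubeStat F N ν g (Kc := Kc) (k := k) a) (inputBlock F ν g a) (fun _ => 1) := by
  letI := Classical.decEq (PBond (F.P Kc) k)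
  funext y
  refine cubeStat_congr_of_agree_inputs F N ν g Kc k hk a fun c hc => ?_
  have hcb : c ∈ inputBlock F ν g a := (Set.Finite.mem_toFinset _).2 hc
  show Function.updateFinset x (inputBlock F ν g a) y c = Function.updateFinset (fun _ => (1 : SU N)) (inputBlock F ν g a) y c
  rw [Function.updateFinset_def, Function.updateFinset_def]
  simp only [dif_pos hcb]

end Locality

/-! ## §3 THE END: N21's face at the record from (M1) for the block fibre laws of record on the input blocks, one function of the block variables -/

section TheEnd

variable {F : T4Family} {N : ℕ} [NeZero N]

/-- ★★★★ **N21 AT THE SPINE READING OF RECORD WITH ITS SHELL SPLIT — FROM (M1) ON THE BLOCK FIBRE LAWS OF RECORD.**  On the live-selector line, under n20-d's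
extraction rows (`hsel`, (H-U), (H-ζ), `0 ≤ ζ`), width letters `0 ≤ ρ`, constants `0 ≤ D`, `Summable (D_K ρ_K)` per
run, and — THE ONE DISPLAYED ESTIMATE — for every (run, K, `|t| ≤ 1`, top cube `a`, exterior field `x`):
`SlotAntiConcentration (blockFibreLawOfDatum₉ … t a (inputBlock a) x) (blockReading (cubeStat a) (inputBlock a) 1) ε_k ρ_K D_K`, THEN `ShellWeightBound` holds AT
`crOfRecord₁₃At K₀ jcut (shellSplitOfRecord₁₃At N K₀ ρA ρB)` (its carriers and canonical `Wsh`). [bookkeeping] -/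
theorem shellWeightBound_crOfRecord₁₃At_shellSplit_of_blockFibreAC (K₀ : ℕ) (jcut : ℕ → ℕ) (ρA ρB : WidthLetter₁₃CoPH N) (θ : Stage13HParams F N)
    (hP : θ.Provisos₁₃CoPH F N) (g₀ : ℕ → ℝ) (os : List (ULoop F)) (E : B12.RunParams → ℝ)
    (hsel : θ.ppSel = ppSelLiveOfRecord F N θ.ν θ.τ9 E (wOfRecord₉ F N θ.toStage9Params))
    (hU : LocalBgMeasurable F N θ.ν) (hζm : ZetaMeasurable F N θ.ζ) (hζ0 : ∀ p g k s Pl Ql RS U V', 0 ≤ θ.ζ p g k s Pl Ql RS U V')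
    {DA DB : ℕ → ℝ} (hρA : ∀ K, 0 ≤ ρA F θ hP g₀ os K) (hDA : ∀ K, 0 ≤ DA K) (hρB : ∀ K, 0 ≤ ρB F θ hP g₀ os K) (hDB : ∀ K, 0 ≤ DB K)
    (hsA : Summable (fun K => DA K * ρA F θ hP g₀ os K)) (hsB : Summable (fun K => DB K * ρB F θ hP g₀ os K))
    (hfibA : ∀ (K : ℕ) (t : ℝ), |t| ≤ 1 →
      ∀ (a : ↥(cubeIndices (F.P (K₀ + K)) (cubeSide (F.P (K₀ + K)).L θ.ν.M₂ (RkOfRecord (F.P (K₀ + K)).L θ.ν.r (histA₁₃ θ K₀ g₀ K (K₀ + K))) (K₀ + K))))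
        (x : GaugeField (F.P (K₀ + K)) (K₀ + K) (SU N)),
        SlotAntiConcentration
          (blockFibreLawOfDatum₉ F N θ.toStage9Params (datumOfRecord₁₃CoPH F N θ hP) g₀ os (runA₁₃ F K₀ g₀ K) (histA₁₃ θ K₀ g₀ K) (K₀ + K) t a
            (inputBlock F θ.ν (histA₁₃ θ K₀ g₀ K) a) x)
          (blockReading N (cubeStat F N θ.ν (histA₁₃ θ K₀ g₀ K) (Kc := K₀ + K) (k := K₀ + K) a) (inputBlock F θ.ν (histA₁₃ θ K₀ g₀ K) a) (fun _ => 1))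
          (epsOfRecord θ.ν (histA₁₃ θ K₀ g₀ K) (K₀ + K)) (ρA F θ hP g₀ os K) (DA K))
    (hfibB : ∀ (K : ℕ) (t : ℝ), |t| ≤ 1 →
      ∀ (a : ↥(cubeIndices (F.P (K₀ + K + 1)) (cubeSide (F.P (K₀ + K + 1)).L θ.ν.M₂
          (RkOfRecord (F.P (K₀ + K + 1)).L θ.ν.r (histB₁₃ θ K₀ g₀ K (K₀ + K + 1))) (K₀ + K + 1))))
        (x : GaugeField (F.P (K₀ + K + 1)) (K₀ + K + 1) (SU N)),
        SlotAntiConcentration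
          (blockFibreLawOfDatum₉ F N θ.toStage9Params (datumOfRecord₁₃CoPH F N θ hP) g₀ os (runB₁₃ F K₀ g₀ K) (histB₁₃ θ K₀ g₀ K) (K₀ + K + 1) t a
            (inputBlock F θ.ν (histB₁₃ θ K₀ g₀ K) a) x)
          (blockReading N (cubeStat F N θ.ν (histB₁₃ θ K₀ g₀ K) (Kc := K₀ + K + 1) (k := K₀ + K + 1) a) (inputBlock F θ.ν (histB₁₃ θ K₀ g₀ K) a) (fun _ => 1))
          (epsOfRecord θ.ν (histB₁₃ θ K₀ g₀ K) (K₀ + K + 1)) (ρB F θ hP g₀ os K) (DB K)) :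
    ShellWeightBound (crOfRecord₁₃At K₀ jcut (shellSplitOfRecord₁₃At N K₀ ρA ρB) F θ hP g₀ os).l₀
      (crOfRecord₁₃At K₀ jcut (shellSplitOfRecord₁₃At N K₀ ρA ρB) F θ hP g₀ os).T (crOfRecord₁₃At K₀ jcut (shellSplitOfRecord₁₃At N K₀ ρA ρB) F θ hP g₀ os).A
      (crOfRecord₁₃At K₀ jcut (shellSplitOfRecord₁₃At N K₀ ρA ρB) F θ hP g₀ os).B (crOfRecord₁₃At K₀ jcut (shellSplitOfRecord₁₃At N K₀ ρA ρB) F θ hP g₀ os).shA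
      (crOfRecord₁₃At K₀ jcut (shellSplitOfRecord₁₃At N K₀ ρA ρB) F θ hP g₀ os).shB (crOfRecord₁₃At K₀ jcut (shellSplitOfRecord₁₃At N K₀ ρA ρB) F θ hP g₀ os).Wsh := by
  have hD : (datumOfRecord₁₃CoPH F N θ hP).AvgMeasurable := (isPrintedAveraged_datumOfRecord₁₃CoPH F N θ hP).avgMeasurable
  have hw0 : ∀ (p : B12.RunParams) (g : ℕ → ℝ) k s' U V', 0 ≤ wOfRecord₉ F N θ.toStage9Params p g k s' U V' :=
    fun p g => wOfRecord₉_nonneg θ.toStage9Params hζ0 p g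
  refine shellWeightBound_crOfRecord₁₃At_shellSplit_of_liveSel K₀ jcut ρA ρB θ hP g₀ os E hsel hU hζm hζ0 hρA hDA hρB hDB hsA hsB
    (fun K t ht a => ?_) (fun K t ht a => ?_)
  · -- run A: the law bridge ∘ the block disintegration ∘ locality, at the cube statistic of record
    refine cubeAC_of_slotAntiConcentration F N θ.toStage9Params (datumOfRecord₁₃CoPH F N θ hP) g₀ os (runA₁₃ F K₀ g₀ K) (histA₁₃ θ K₀ g₀ K) (K₀ + K)
      hU (hw0 _ _) (hρA K) t a (fun s => integrable_topPieceA_of_liveSel K₀ θ hP E hsel hU hζm hζ0 g₀ os K t s)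
      (cubeStat F N θ.ν (histA₁₃ θ K₀ g₀ K) (Kc := K₀ + K) (k := K₀ + K) a)
      (fun V => cubeStat_lt_iff F N θ.ν (histA₁₃ θ K₀ g₀ K) (K₀ + K) (K₀ + K) a (plaqInside_cubeEnl_nonempty F θ.ν _ _ _ a) _ V)
      (fun V => cubeStat_lt_iff F N θ.ν (histA₁₃ θ K₀ g₀ K) (K₀ + K) (K₀ + K) a (plaqInside_cubeEnl_nonempty F θ.ν _ _ _ a) _ V) (hDA K) ?_
    refine slotAntiConcentration_cubeLaw_of_blockFibres F N θ.toStage9Params (datumOfRecord₁₃CoPH F N θ hP) g₀ os (runA₁₃ F K₀ g₀ K) (histA₁₃ θ K₀ g₀ K)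
      (K₀ + K) hU hζm hD t a (inputBlock F θ.ν (histA₁₃ θ K₀ g₀ K) a) (measurable_cubeStat F N θ.ν (histA₁₃ θ K₀ g₀ K) (K₀ + K) (K₀ + K) hU a) fun x => ?_
    have h := hfibA K t ht a x
    rw [← blockReading_cubeStat_inputBlock F N θ.ν (histA₁₃ θ K₀ g₀ K) (K₀ + K) (K₀ + K) (by omega) a x] at h
    exact h
  · refine cubeAC_of_slotAntiConcentration F N θ.toStage9Params (datumOfRecord₁₃CoPH F N θ hP) g₀ os (runB₁₃ F K₀ g₀ K) (histB₁₃ θ K₀ g₀ K) (K₀ + K + 1)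
      hU (hw0 _ _) (hρB K) t a (fun s' => integrable_topPieceB_of_liveSel K₀ θ hP E hsel hU hζm hζ0 g₀ os K t s')
      (cubeStat F N θ.ν (histB₁₃ θ K₀ g₀ K) (Kc := K₀ + K + 1) (k := K₀ + K + 1) a)
      (fun V => cubeStat_lt_iff F N θ.ν (histB₁₃ θ K₀ g₀ K) (K₀ + K + 1) (K₀ + K + 1) a (plaqInside_cubeEnl_nonempty F θ.ν _ _ _ a) _ V)
      (fun V => cubeStat_lt_iff F N θ.ν (histB₁₃ θ K₀ g₀ K) (K₀ + K + 1) (K₀ + K + 1) a (plaqInside_cubeEnl_nonempty F θ.ν _ _ _ a) _ V) (hDB K) ?_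
    refine slotAntiConcentration_cubeLaw_of_blockFibres F N θ.toStage9Params (datumOfRecord₁₃CoPH F N θ hP) g₀ os (runB₁₃ F K₀ g₀ K) (histB₁₃ θ K₀ g₀ K)
      (K₀ + K + 1) hU hζm hD t a (inputBlock F θ.ν (histB₁₃ θ K₀ g₀ K) a)
      (measurable_cubeStat F N θ.ν (histB₁₃ θ K₀ g₀ K) (K₀ + K + 1) (K₀ + K + 1) hU a) fun x => ?_
    have h := hfibB K t ht a x
    rw [← blockReading_cubeStat_inputBlock F N θ.ν (histB₁₃ θ K₀ g₀ K) (K₀ + K + 1) (K₀ + K + 1) (by omega) a x] at h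
    exact h

end TheEnd

end Summit.QuantumFields.YangMills.Theorems.N21ShellSplitOfRecord13CoPH

end
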